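import Summits.CriticalPhenomena.PercolationContinuityZ3.Theorems.Transplant.KNCellsBoxProdZ2InnerRoute
import Summits.CriticalPhenomena.PercolationContinuityZ3.Theorems.Transplant.BoxProdZ2ConcFace
import HarnessLib

/-!
# The ROUTE WORLD of a face-step contact and the geometry of its inner straight run (design (D), §11 v2; residue (F), `advRoute_of_contact`
# part 4b, built on p2-g2's `innerTAD` / `innerRoute_lt` of KNCellsBoxProdZ2InnerRoute): the planar route world `innerQtPl` (first-hop square
# ∪ rooted regions) and `innerQt = B_X(c, L_A) × innerQtPl`; containments (regions ⊆ world ⊆ `B(w₀, R) × farA`), levels and widths of the rooted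
# cores, separation of the rooted regions from the kit cube by signed levels, the landing face of the first hop inside the first core

builds on p205010 (kernel theorem, internal audit signed; external expert review pending) — nothing in this file uses p205010.
Lane `prim-bschramm`, seat `prim-bschramm-p3` (residue (F) of V56, arbitration 16:02Z / deconflict 16:14Z); helper file
(`--supports stmt-CriticalPhenomena-4575`).

* `innerQtPl`, `innerQt`; `innerTAD_stepDR`, `stepDR_subset_innerQt`, `shift_box_subset_innerQtPl`, `prod_shift_box_subset_innerQt`, `innerQt_fst`,
  `root_mem_innerQt`, **`innerQtPl_subset_farA`**, `innerQt_subset_prod_farA`, `innerQtPl_subset_box_image`; `innerTAD_level_subset`, `innerTAD_wide`;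
  `level_ge_of_mem_aregionR`, `level_le_of_mem_shift_box`, **`disjoint_prod_shift_box_stepDR`**, `root_not_mem_stepDR`, `coreT_last_subset_stepDR`;
  **`fatFace_subset_core_zero`**, `center_mem_frameSeq`.
[cite: KozmaNitzan2024, §4 Lemma 11 (pp. 22–23), p. 30 (Step III)]
-/

noncomputable section

namespace Summit.CriticalPhenomena.PercolationContinuityZ3.Theorems

namespace Transplant

namespace BoxProdZ2

open Literature.Probability.Percolation Literature.Probability.LatticeModels SimpleGraph KNLevels
open Literature.Probability.Percolation.KozmaNitzan
open Literature.Probability.Percolation.KozmaNitzan.Cells (oth oth_ne eq_oth_of_ne sgOf sgOf_sign)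
open Literature.Probability.Percolation.GM
open Literature.Barriers.CriticalPhenomena (graphBall graphBall_finite mem_graphBall_self graphBall_mono)
open ChainPlanar

variable {W : Type} [DecidableEq W] (X : SimpleGraph W) [X.LocallyFinite]

/-! ## §1 The route world -/

/-- **The planar route world of a contact**: the first-hop square `v + Λ_{ℓ₁}` and the rooted regions `regionR k`, `k ≤ nA`.
[cite: KozmaNitzan2024, §4 Lemma 11 (p. 22: Ω)] -/
def innerQtPl (C : PCells) (x : Site 2) (du : MDir) (s₁ : ℤ) (R' nA : ℕ) (ca cb q' : ℤ) (v : Site 2) (ℓ₁ : ℕ) : Finset (Site 2) :=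
  (box 2 ℓ₁).image (fun t => t + v) ∪
    (Finset.range (nA + 1)).biUnion fun k => Adv.regionR 0 s₁ (innerρ q' s₁ R' nA) R' du.1 (sgOf du) (innerCtr C x du ca cb) k

/-- **The route world of a contact**: the inner tube times the planar route world. [cite: KozmaNitzan2024, §4 Lemma 11 (p. 22: Ω)] -/
def innerQt (c : W) (L_A : ℕ) (C : PCells) (x : Site 2) (du : MDir) (s₁ : ℤ) (R' nA : ℕ) (ca cb q' : ℤ) (v : Site 2) (ℓ₁ : ℕ) :
    Finset (W × Site 2) :=
  ballFin X c L_A ×ˢ innerQtPl C x du s₁ R' nA ca cb q' v ℓ₁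

/-! ## §2 Containments -/

section Geom

variable {c : W} {L_A L'A : ℕ} {C : PCells} {x : Site 2} {du : MDir} {s₁ : ℤ} {R' ℓ₀ nA : ℕ} {ca cb q' : ℤ} {Rlev N j₀ j₁ : ℕ}
  {o : W × Site 2} {v : Site 2} {Sfin : Finset (W × Site 2)}

/-- The rooted region `k` of the inner run unfolded. [folklore] -/
theorem innerTAD_stepDR (k : ℕ) :
    (innerTAD X c L_A L'A C x du ca cb q' s₁ R' ℓ₀ nA Rlev N j₀ j₁ o Sfin).stepDR k =
      ballFin X c L_A ×ˢ Adv.regionR 0 s₁ (innerρ q' s₁ R' nA) R' du.1 (sgOf du) (innerCtr C x du ca cb) k := rfl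

/-- **The rooted regions `k ≤ nA` lie in the route world.** [folklore] -/
theorem stepDR_subset_innerQt {k : ℕ} (hk : k ≤ nA) (v : Site 2) (ℓ₁ : ℕ) :
    (innerTAD X c L_A L'A C x du ca cb q' s₁ R' ℓ₀ nA Rlev N j₀ j₁ o Sfin).stepDR k ⊆ innerQt X c L_A C x du s₁ R' nA ca cb q' v ℓ₁ := by
  rw [innerTAD_stepDR, innerQt]
  refine Finset.product_subset_product le_rfl fun y hy => ?_
  rw [innerQtPl]
  exact Finset.mem_union_right _ (Finset.mem_biUnion.2 ⟨k, Finset.mem_range.2 (Nat.lt_succ_of_le hk), hy⟩)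

/-- **The first-hop square lies in the planar route world.** [folklore] -/
theorem shift_box_subset_innerQtPl (ℓ₁ : ℕ) : (box 2 ℓ₁).image (fun t => t + v) ⊆ innerQtPl C x du s₁ R' nA ca cb q' v ℓ₁ := by
  rw [innerQtPl]; exact Finset.subset_union_left

omit [DecidableEq W] in
/-- **A product set over the first-hop square with fibres in the inner tube lies in the route world.** [folklore] -/
theorem prod_shift_box_subset_innerQt {B : Finset W} (hB : B ⊆ ballFin X c L_A) (ℓ₁ : ℕ) :
    B ×ˢ (box 2 ℓ₁).image (fun t => t + v) ⊆ innerQt X c L_A C x du s₁ R' nA ca cb q' v ℓ₁ := by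
  rw [innerQt]; exact Finset.product_subset_product hB (shift_box_subset_innerQtPl ℓ₁)

omit [DecidableEq W] in
/-- The fibres of the route world lie in the inner tube. [folklore] -/
theorem innerQt_fst {ℓ₁ : ℕ} {u : W × Site 2} (hu : u ∈ innerQt X c L_A C x du s₁ R' nA ca cb q' v ℓ₁) : u.1 ∈ ballFin X c L_A :=
  (Finset.mem_product.1 hu).1

omit [DecidableEq W] in
/-- The centre `(c, v)` lies in the route world. [folklore] -/
theorem root_mem_innerQt (ℓ₁ : ℕ) : ((c, v) : W × Site 2) ∈ innerQt X c L_A C x du s₁ R' nA ca cb q' v ℓ₁ := by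
  classical
  rw [innerQt, Finset.mem_product]
  refine ⟨(mem_ballFin X).2 (mem_graphBall_self X c _), shift_box_subset_innerQtPl ℓ₁ (Finset.mem_image.2 ⟨0, ?_, zero_add v⟩)⟩
  rw [mem_box]; intro i; simp

/-- **The planar route world lies in `farA x du j`**: the regions by `innerRun_regionR_subset_farA`, the first-hop square when its levels
`[lv - ℓ₁, lv + ℓ₁]` lie in `[5r + 10 s j + 1, 25 r]` and its transverse extent within `5r` (`lv` the signed level of `v`).
[cite: KozmaNitzan2024, §4 Lemma 11 (p. 22: Ω), p. 30] -/
theorem innerQtPl_subset_farA {j : ℕ} (h : InnerRunOK C j s₁ R' ℓ₀ nA ca cb q') {ℓ₁ : ℕ}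
    (h1 : 5 * (C.r : ℤ) + 10 * C.s * j + 1 ≤ sgOf du * (v du.1 - C.cen x du.1) - ℓ₁)
    (h2 : sgOf du * (v du.1 - C.cen x du.1) + ℓ₁ ≤ 25 * (C.r : ℤ))
    (h3 : C.cen x (oth du.1) - 5 * (C.r : ℤ) ≤ v (oth du.1) - ℓ₁) (h4 : v (oth du.1) + ℓ₁ ≤ C.cen x (oth du.1) + 5 * (C.r : ℤ)) :
    innerQtPl C x du s₁ R' nA ca cb q' v ℓ₁ ⊆ C.farA x du j := by
  rw [innerQtPl]
  refine Finset.union_subset ?_ (Finset.biUnion_subset.2 fun k hk => innerRun_regionR_subset_farA h (Nat.le_of_lt_succ (Finset.mem_range.1 hk)))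
  rw [PCells.farA]
  refine shift_box_subset_sBox (sgOf_sign du) h1 h2 fun i hi => ?_
  rw [eq_oth_of_ne hi]; exact ⟨h3, h4⟩

omit [DecidableEq W] in
/-- **The route world lies in the face-step region `B(w₀, R) × farA`** when the inner tube lies in `B(w₀, R)`. [folklore] -/
theorem innerQt_subset_prod_farA {w₀ : W} {R : ℕ} (hdeep : ballFin X c L_A ⊆ ballFin X w₀ R) {j : ℕ} (h : InnerRunOK C j s₁ R' ℓ₀ nA ca cb q')
    {ℓ₁ : ℕ} (h1 : 5 * (C.r : ℤ) + 10 * C.s * j + 1 ≤ sgOf du * (v du.1 - C.cen x du.1) - ℓ₁)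
    (h2 : sgOf du * (v du.1 - C.cen x du.1) + ℓ₁ ≤ 25 * (C.r : ℤ))
    (h3 : C.cen x (oth du.1) - 5 * (C.r : ℤ) ≤ v (oth du.1) - ℓ₁) (h4 : v (oth du.1) + ℓ₁ ≤ C.cen x (oth du.1) + 5 * (C.r : ℤ)) :
    innerQt X c L_A C x du s₁ R' nA ca cb q' v ℓ₁ ⊆ ballFin X w₀ R ×ˢ C.farA x du j := by
  rw [innerQt]; exact Finset.product_subset_product hdeep (innerQtPl_subset_farA h h1 h2 h3 h4)

/-- The planar route world lies in `cen x + Λ_{25 r}`. [folklore] -/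
theorem innerQtPl_subset_box_image {j : ℕ} (h : InnerRunOK C j s₁ R' ℓ₀ nA ca cb q') {ℓ₁ : ℕ}
    (h1 : 5 * (C.r : ℤ) + 10 * C.s * j + 1 ≤ sgOf du * (v du.1 - C.cen x du.1) - ℓ₁)
    (h2 : sgOf du * (v du.1 - C.cen x du.1) + ℓ₁ ≤ 25 * (C.r : ℤ))
    (h3 : C.cen x (oth du.1) - 5 * (C.r : ℤ) ≤ v (oth du.1) - ℓ₁) (h4 : v (oth du.1) + ℓ₁ ≤ C.cen x (oth du.1) + 5 * (C.r : ℤ)) :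
    innerQtPl C x du s₁ R' nA ca cb q' v ℓ₁ ⊆ (box 2 (25 * C.r)).image (fun s => s + C.cen x) :=
  ((innerQtPl_subset_farA h h1 h2 h3 h4).trans (C.farA_subset_Efar x du j)).trans (C.Efar_subset_box_image x du)

/-! ## §3 Levels and widths of the rooted cores -/

/-- **The levels `j ≤ Rlev + 1` of the rooted step `k ≤ nA` lie in its region** (`Rlev + 1 ≤ R'`). [cite: KozmaNitzan2024, §4 Lemma 10 (p. 17)] -/
theorem innerTAD_level_subset {j' : ℕ} (h : InnerRunOK C j' s₁ R' ℓ₀ nA ca cb q') (hRl : Rlev + 1 ≤ R') {k : ℕ} (hk : k ≤ nA) {j : ℕ}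
    (hj : j ≤ Rlev + 1) :
    let P := innerTAD X c L_A L'A C x du ca cb q' s₁ R' ℓ₀ nA Rlev N j₀ j₁ o Sfin
    tubeLevel P.π (P.alo k) (P.ahi k) j ⊆ P.stepDR k := by
  intro P
  have h1 : tubeLevel P.π (P.alo k) (P.ahi k) j ⊆ tubeLevel P.π (P.alo k) (P.ahi k) (P.Rlev + 1) := tubeLevel_monotone P.π _ _ hj
  have h2 := TubeAdvData.enclR X (P := P) (sgOf_sign du) (innerRun_advOK h) hRl hk
  rw [TubeAdvData.stepL, tubeLData_X] at h2
  exact h1.trans h2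

/-- **Every level `j ≥ M + 1` of every rooted core is at least `2M + 2` wide in each coordinate** (the cores are nonempty rows).
[folklore] -/
theorem innerTAD_wide {j' : ℕ} (h : InnerRunOK C j' s₁ R' ℓ₀ nA ca cb q') (k : ℕ) {M j : ℕ} (hMj : M + 1 ≤ j) :
    let P := innerTAD X c L_A L'A C x du ca cb q' s₁ R' ℓ₀ nA Rlev N j₀ j₁ o Sfin
    ∀ i, (P.alo k - ((j : ℕ) : Site 2)) i + 2 * M + 2 ≤ (P.ahi k + ((j : ℕ) : Site 2)) i := by
  intro P i
  have hne := Adv.core_nonempty (sgOf_sign du) (innerCtr C x du ca cb) (innerRun_advOK h) k (a := du.1)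
  have hle : P.alo k ≤ P.ahi k := Finset.nonempty_Icc.1 hne
  have hk := hle i
  have hMj' : (M : ℤ) + 1 ≤ j := by exact_mod_cast hMj
  simp only [Pi.sub_apply, Pi.add_apply, Pi.natCast_apply]
  linarith

/-! ## §4 Signed levels: the regions lie above the kit cube -/

omit [DecidableEq W] in
/-- **Every vertex of a rooted region `k ≤ nA` has signed level `≥ ca - (s₁ + 2R')`.** [cite: KozmaNitzan2024, §4 Lemma 11 (p. 22: Ω)] -/
theorem level_ge_of_mem_aregionR {j : ℕ} (h : InnerRunOK C j s₁ R' ℓ₀ nA ca cb q') {k : ℕ} (hk : k ≤ nA) {y : Site 2}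
    (hy : y ∈ Adv.regionR 0 s₁ (innerρ q' s₁ R' nA) R' du.1 (sgOf du) (innerCtr C x du ca cb) k) :
    ca - (s₁ + 2 * R') ≤ sgOf du * (y du.1 - C.cen x du.1) := by
  have hy' := Adv.regionR_subset_prism (sgOf_sign du) (innerCtr C x du ca cb) (innerRun_advOK h) hk hy
  rw [PCells.mem_psBox_iff] at hy'
  simp only [innerCtr_fst, sg_mul_sub_add, Adv.ρ₀] at hy'
  linarith [hy'.1.1]

omit [DecidableEq W] in
/-- **A point of the shifted square `v + Λ_m` has signed level `≤ lv + m`** (`lv` the signed level of `v`). [folklore] -/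
theorem level_le_of_mem_shift_box {m : ℕ} {y : Site 2} (hy : y ∈ (box 2 m).image (fun t => t + v)) :
    sgOf du * (y du.1 - C.cen x du.1) ≤ sgOf du * (v du.1 - C.cen x du.1) + m := by
  obtain ⟨t, ht, rfl⟩ := Finset.mem_image.1 hy
  rw [mem_box] at ht
  have := ht du.1
  simp only [Pi.add_apply]
  rcases sgOf_sign du with hs | hs <;> rw [hs] <;> linarith [this.1, this.2]

/-- **A product set over a shifted square `v + Λ_m` misses every rooted region** when `lv + m < ca - (s₁ + 2R')`. [folklore] -/
theorem disjoint_prod_shift_box_stepDR {j : ℕ} (h : InnerRunOK C j s₁ R' ℓ₀ nA ca cb q') {k : ℕ} (hk : k ≤ nA) {m : ℕ}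
    (hsep : sgOf du * (v du.1 - C.cen x du.1) + m < ca - (s₁ + 2 * R')) (B : Finset W) :
    Disjoint (B ×ˢ (box 2 m).image (fun t => t + v)) ((innerTAD X c L_A L'A C x du ca cb q' s₁ R' ℓ₀ nA Rlev N j₀ j₁ o Sfin).stepDR k) := by
  rw [innerTAD_stepDR, Finset.disjoint_left]
  intro u hu hu'
  have h1 := level_le_of_mem_shift_box (C := C) (x := x) (du := du) (Finset.mem_product.1 hu).2
  have h2 := level_ge_of_mem_aregionR h hk (Finset.mem_product.1 hu').2
  linarith

/-- **The centre `(c, v)` is off every rooted region** when `lv < ca - (s₁ + 2R')`. [folklore] -/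
theorem root_not_mem_stepDR {j : ℕ} (h : InnerRunOK C j s₁ R' ℓ₀ nA ca cb q') {k : ℕ} (hk : k ≤ nA)
    (hsep : sgOf du * (v du.1 - C.cen x du.1) < ca - (s₁ + 2 * R')) :
    ((c, v) : W × Site 2) ∉ (innerTAD X c L_A L'A C x du ca cb q' s₁ R' ℓ₀ nA Rlev N j₀ j₁ o Sfin).stepDR k := by
  intro hm
  rw [innerTAD_stepDR] at hm
  have h2 := level_ge_of_mem_aregionR h hk (Finset.mem_product.1 hm).2
  simp only at h2
  linarith

/-- The last true target lies in the last rooted region. [folklore] -/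
theorem coreT_last_subset_stepDR {j : ℕ} (h : InnerRunOK C j s₁ R' ℓ₀ nA ca cb q') :
    (innerTAD X c L_A L'A C x du ca cb q' s₁ R' ℓ₀ nA Rlev N j₀ j₁ o Sfin).coreT nA ⊆
      (innerTAD X c L_A L'A C x du ca cb q' s₁ R' ℓ₀ nA Rlev N j₀ j₁ o Sfin).stepDR nA :=
  TubeAdvData.coreT_subset_stepDR (P := innerTAD X c L_A L'A C x du ca cb q' s₁ R' ℓ₀ nA Rlev N j₀ j₁ o Sfin) (sgOf_sign du)
    (innerRun_advOK h) le_rfl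

/-! ## §5 The landing face of the first hop -/

omit [DecidableEq W] in
/-- **The landing quarter-face of the first hop lies in the first core**: for the signs `τ' du.1 = sgOf du`, `τ' (oth du.1) = 1`, the first-hop scale
`ℓ₁` with `ca = lv + ℓ₁`, `cb` the transverse offset of `v` and `q' = ℓ₁`, the fat face `B × (v + F_{du.1, τ'}(ℓ₁))`, `B ⊆ B(c, L_A)`, lies in
`B(c, L_A) × core 0` — the `hB₀` of p2-g2's `innerRoute_lt`. [cite: KozmaNitzan2024, §4 Lemma 11 (p. 22: the first cube)] -/
theorem fatFace_subset_core_zero {τ' : Fin 2 → ℤˣ} (hτ : (τ' du.1 : ℤ) = sgOf du) (hτ' : (τ' (oth du.1) : ℤ) = 1) {ℓ₁ : ℕ}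
    (hca : ca = sgOf du * (v du.1 - C.cen x du.1) + ℓ₁) (hcb : cb = v (oth du.1) - C.cen x (oth du.1)) (hq' : q' = ℓ₁)
    {B : Finset W} (hB : B ⊆ ballFin X c L_A) :
    B ×ˢ (orthantFace du.1 τ' ℓ₁).image (fun t => t + v) ⊆ ballFin X c L_A ×ˢ Adv.core 0 q' s₁ R' du.1 (sgOf du) (innerCtr C x du ca cb) 0 := by
  refine Finset.product_subset_product hB fun y hy => ?_
  obtain ⟨t, ht, rfl⟩ := Finset.mem_image.1 hy
  rw [mem_orthantFace] at ht
  obtain ⟨htb, hta, htj⟩ := ht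
  rw [mem_box] at htb
  rw [mem_innerCore_zero]
  have hσσ : sgOf du * sgOf du = 1 := by rcases sgOf_sign du with hs | hs <;> simp [hs]
  have hta' : t du.1 = sgOf du * ℓ₁ := by
    rw [hτ] at hta
    calc t du.1 = sgOf du * sgOf du * t du.1 := by rw [hσσ, one_mul]
      _ = sgOf du * ℓ₁ := by rw [mul_assoc, hta]
  have ht2 := htj (oth du.1) (oth_ne du.1)
  rw [hτ', one_mul] at ht2
  have ht3 := (htb (oth du.1)).2
  simp only [Pi.add_apply]
  refine ⟨?_, ?_, ?_⟩
  · rw [hca, hta']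
    calc sgOf du * (sgOf du * ↑ℓ₁ + v du.1 - C.cen x du.1) = sgOf du * sgOf du * ℓ₁ + sgOf du * (v du.1 - C.cen x du.1) := by ring
      _ = sgOf du * (v du.1 - C.cen x du.1) + ℓ₁ := by rw [hσσ]; ring
  · rw [hcb, hq']; linarith
  · rw [hcb, hq']; linarith

/-- **The centre `(c, v)` lies in every frame prism around it.** [folklore] -/
theorem center_mem_frameSeq [Countable W] {p : unitInterval} (hT : TubeSubcritical X p) (V₀ : Finset W) (γ : X ≃g X) (m : ℕ) :
    ((c, v) : W × Site 2) ∈ frameSeq X hT V₀ γ v (γ c) m := by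
  classical
  rw [frameSeq_eq_product, Finset.mem_product]
  refine ⟨(mem_ballFin X).2 (mem_graphBall_self X c _), Finset.mem_image.2 ⟨0, ?_, zero_add v⟩⟩
  rw [mem_box]; intro i; simp

end Geom

end BoxProdZ2

end Transplant

end Summit.CriticalPhenomena.PercolationContinuityZ3.Theorems

end
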